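import Mathlib
import HarnessLib
import Literature.Analysis.FluidPDE.LocalTypeI
import Literature.Analysis.FluidPDE.LocalTypeIReverseTools
import Literature.Analysis.FluidPDE.LocalTypeILscPressure
import Literature.Analysis.FluidPDE.ChaeAsymptoticallySelfSimilarLocalLeray
import Literature.Analysis.FluidPDE.ClassicalSolution
import Literature.Analysis.FunctionSpaces.PoincareGluing
import Summits.NavierStokesRegularity.NavierStokesRegularity.Theorems.SqueezeCycleNoApexTypeIProfileEnvelopeTypeIBound

/-!
# AxisTwistDoor · crux `TiltDominationLoc` (stmt-NavierStokesRegularity-26991) — tools: Albritton–Barker's scaled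
# quantities `A, C, D, E` on a past ball from INTEGRATED a-priori bounds (measure-theoretic conversions only)

The route's ENERGY CLASS hypotheses (`IsSuitableWeakSolutionOn` on the slab, a weak gradient, `𝐈 < ∞`) are consequences
of the four Type-I-mild hypotheses (rate, continuity, Oseen identity, divergence-free slices): the a-priori package of
the K2 lineage (`…SparseEnergyScaledEnergy.stub_scaledEnergy`, `…ScaledCubic.scaledCubic`,
`…ScaledPressureD.scaledPressure_threeHalves`) bounds the slice energy, the space–time enstrophy, the cubic quantity
and the pressure oscillation of every profile of the class at every scale, up to the apex.  This file converts such
ITERATED-integral bounds into bounds on the four summands of `abScaledSum r z` for every past ball `Q(z,r)`, `z.1 ≤ 0`: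

* `cknAEss_le_of_slice` (`A`), `cknC_le_of_iterated` (`C`), `cknE_le_of_iterated` (`E`, Frobenius `≤ 3·`operator norm),
  `cknDOsc_le_of_iterated` (`D`, mean-free: the ball mean is within a factor `4` of ANY constant `c(t)`, measurable or
  not — `lintegral_ball_sub_average_le`), `cknDOsc_congr_slices` (the mean-free `D` only sees the slices of the ball);
* `pressure_sub_eq_of_classical` — two classical pressures of one velocity field on a common open time set differ by a
  function of time (so `D` does not see the choice of pressure, `cknDOsc_sub_fun_time`).

Tonelli is used only as the INEQUALITY `∫⁻_{I×B} ≤ ∫⁻_I ∫⁻_B` (`lintegral_prod_le`), so no measurability is needed.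
The assembly `𝐈 < ∞` / «the energy class is automatic» is `…Theorems.AxisTwistDoorTiltDominationLocEnergyClass`.
WHAT THIS IS NOT: no statement about Navier–Stokes regularity; bookkeeping for hypothetical Type-I profiles.
Seat ns-atd-p1 (LEAD g3). [cite: AlbrittonBarker2019, §1; CaffarelliKohnNirenberg1982, §2]
-/

noncomputable section

-- the summit and its single sub-problem share the name (CONVENTIONS §1), as in every Theorems file
set_option linter.dupNamespace false

namespace Summit.NavierStokesRegularity.NavierStokesRegularity.Theorems.AxisTwistDoorTiltDominationLocScaledQuantities

open Set Function Filter Topology MeasureTheory Metric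
open scoped ENNReal NNReal
open Literature.Analysis Literature.Analysis.FluidPDE

variable {v : ℝ → EuclideanSpace ℝ (Fin 3) → EuclideanSpace ℝ (Fin 3)} {r : ℝ} {z : ℝ × EuclideanSpace ℝ (Fin 3)}

/-! ### Tonelli as an inequality on a cylinder -/

/-- `∫⁻_{I × B} f ≤ ∫⁻_{t∈I} ∫⁻_{x∈B} f(t,x)` for EVERY `f ≥ 0` (no measurability). -/
theorem setLIntegral_prod_le (I : Set ℝ) (B : Set (EuclideanSpace ℝ (Fin 3))) (f : ℝ × EuclideanSpace ℝ (Fin 3) → ℝ≥0∞) :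
    ∫⁻ w in I ×ˢ B, f w ≤ ∫⁻ t in I, ∫⁻ x in B, f (t, x) := by
  rw [volume_restrict_prod_eq]
  exact lintegral_prod_le f

/-- `(ofReal r ^ 2)⁻¹ · ofReal (K r²) = ofReal K` for `r > 0`. -/
theorem ofReal_sq_inv_mul (hr : 0 < r) (K : ℝ) :
    (ENNReal.ofReal r ^ 2)⁻¹ * ENNReal.ofReal (K * r ^ 2) = ENNReal.ofReal K := by
  rw [← ENNReal.ofReal_pow hr.le, ← ENNReal.ofReal_inv_of_pos (by positivity),
    ← ENNReal.ofReal_mul (inv_nonneg.2 (by positivity))]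
  congr 1
  field_simp

/-- A past ball `Q(z,r) ⊆ (−∞,0) × ℝ³` has top time `z.1 ≤ 0`. -/
theorem top_nonpos_of_subset_slab (hr : 0 < r)
    (hz : parabolicCylinder r z ⊆ Iio (0 : ℝ) ×ˢ (univ : Set (EuclideanSpace ℝ (Fin 3)))) : z.1 ≤ 0 := by
  by_contra hz0
  push Not at hz0
  have hε0 : 0 < min (r ^ 2 / 2) (z.1 / 2) := lt_min (by positivity) (by linarith)
  have hw : (z.1 - min (r ^ 2 / 2) (z.1 / 2), z.2) ∈ parabolicCylinder r z := by
    rw [mem_parabolicCylinder]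
    refine ⟨⟨?_, ?_⟩, by simpa using hr⟩
    · have : min (r ^ 2 / 2) (z.1 / 2) ≤ r ^ 2 / 2 := min_le_left _ _
      dsimp only; nlinarith [sq_nonneg r]
    · dsimp only; linarith
  have h1 : z.1 - min (r ^ 2 / 2) (z.1 / 2) < 0 := (hz hw).1
  have h2 : min (r ^ 2 / 2) (z.1 / 2) ≤ z.1 / 2 := min_le_right _ _
  linarith

/-! ### `A` from a slice energy bound -/

/-- **`A(Q(z,r)) ≤ K`** from `∫_{B_R(a)} |v(t)|² ≤ K R` for all `t < 0`, all centres and radii (`z.1 ≤ 0`). -/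
theorem cknAEss_le_of_slice {K : ℝ}
    (hA : ∀ t < 0, ∀ (a : EuclideanSpace ℝ (Fin 3)) (R : ℝ), 0 < R →
      (∫⁻ x in ball a R, ENNReal.ofReal (‖v t x‖ ^ 2)) ≤ ENNReal.ofReal (K * R))
    (hr : 0 < r) (hz : z.1 ≤ 0) : cknAEss r z v ≤ ENNReal.ofReal K := by
  refine cknAEss_le_cknA.trans ?_
  refine iSup₂_le fun t ht => ?_
  have ht0 : t < 0 := lt_of_lt_of_le ht.2 hz
  have h1 : (∫⁻ x in ball z.2 r, ‖v t x‖ₑ ^ 2) ≤ ENNReal.ofReal (K * r) := by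
    refine le_trans (le_of_eq (lintegral_congr fun x => ?_)) (hA t ht0 z.2 r hr)
    rw [← ofReal_norm, ENNReal.ofReal_pow (norm_nonneg _)]
  calc (ENNReal.ofReal r)⁻¹ * ∫⁻ x in ball z.2 r, ‖v t x‖ₑ ^ 2
      ≤ (ENNReal.ofReal r)⁻¹ * ENNReal.ofReal (K * r) := by gcongr
    _ = ENNReal.ofReal K := NoApexEnvelope.ofReal_inv_mul_ofReal_mul hr K

/-! ### `C` from an iterated cubic bound -/

/-- **`C(Q(z,r)) ≤ K₃`** from `∫⁻_{t₀−R²<t<t₀} ∫⁻_{B_R(a)} |v|³ ≤ K₃ R²` for all `t₀ ≤ 0` (apex time included). -/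
theorem cknC_le_of_iterated {K₃ : ℝ}
    (hC : ∀ t₀ : ℝ, t₀ ≤ 0 → ∀ (a : EuclideanSpace ℝ (Fin 3)) (R : ℝ), 0 < R →
      (∫⁻ t in Ioo (t₀ - R ^ 2) t₀, ∫⁻ x in ball a R, ENNReal.ofReal (‖v t x‖ ^ 3)) ≤ ENNReal.ofReal (K₃ * R ^ 2))
    (hr : 0 < r) (hz : z.1 ≤ 0) : cknC r z v ≤ ENNReal.ofReal K₃ := by
  unfold cknC
  have h1 : (∫⁻ q in parabolicCylinder r z, ‖v q.1 q.2‖ₑ ^ (3 : ℕ)) ≤ ENNReal.ofReal (K₃ * r ^ 2) := by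
    refine (setLIntegral_prod_le _ _ _).trans ?_
    refine le_trans (le_of_eq ?_) (hC z.1 hz z.2 r hr)
    refine lintegral_congr fun t => lintegral_congr fun x => ?_
    rw [← ofReal_norm, ENNReal.ofReal_pow (norm_nonneg _)]
  calc (ENNReal.ofReal r ^ 2)⁻¹ * ∫⁻ q in parabolicCylinder r z, ‖v q.1 q.2‖ₑ ^ (3 : ℕ)
      ≤ (ENNReal.ofReal r ^ 2)⁻¹ * ENNReal.ofReal (K₃ * r ^ 2) := by gcongr
    _ = ENNReal.ofReal K₃ := ofReal_sq_inv_mul hr K₃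

/-! ### `E` from an iterated enstrophy bound -/

/-- The enstrophy bound before every NEGATIVE time extends to the apex time `t₀ = 0` (monotone convergence in the
time set, `setLIntegral_iUnion_of_directed`; no measurability). -/
theorem iterated_le_of_lt {G : ℝ → ℝ≥0∞} {M : ℝ≥0∞}
    (hE : ∀ t₀ < 0, (∫⁻ t in Iio t₀, G t) ≤ M) {t₀ : ℝ} (ht₀ : t₀ ≤ 0) :
    (∫⁻ t in Iio t₀, G t) ≤ M := by
  rcases lt_or_eq_of_le ht₀ with h | h
  · exact hE t₀ h
  · subst h
    have hU : Iio (0 : ℝ) = ⋃ n : ℕ, Iio (-((n : ℝ) + 1)⁻¹) := by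
      ext t
      simp only [mem_Iio, mem_iUnion]
      constructor
      · intro ht
        obtain ⟨n, hn⟩ := exists_nat_gt (-t)⁻¹
        refine ⟨n, ?_⟩
        have hnt : 0 < -t := neg_pos.2 ht
        have h1 : (-t)⁻¹ < (n : ℝ) + 1 := hn.trans (by linarith)
        have h2 : ((n : ℝ) + 1)⁻¹ < -t := by
          rw [inv_lt_comm₀ (by positivity) hnt]; exact h1
        linarith
      · rintro ⟨n, hn⟩
        exact hn.trans (by simp; positivity)
    have hdir : Directed (· ⊆ ·) fun n : ℕ => Iio (-((n : ℝ) + 1)⁻¹) := by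
      refine Monotone.directed_le fun m n hmn => Iio_subset_Iio ?_
      have : ((n : ℝ) + 1)⁻¹ ≤ ((m : ℝ) + 1)⁻¹ :=
        inv_anti₀ (by positivity) (by exact_mod_cast Nat.succ_le_succ hmn)
      linarith
    rw [hU, setLIntegral_iUnion_of_directed _ hdir]
    exact iSup_le fun n => hE _ (by simp; positivity)

/-- **`E(Q(z,r); ∇v) ≤ 3K`** from `∫⁻_{t<t₀} ∫⁻_{B_R(a)} ‖∇v‖² ≤ K R` for all `t₀ < 0` (Frobenius `≤ 3·`operator norm). -/
theorem cknE_le_of_iterated {K : ℝ}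
    (hE : ∀ t₀ < 0, ∀ (a : EuclideanSpace ℝ (Fin 3)) (R : ℝ), 0 < R →
      (∫⁻ t in Iio t₀, ∫⁻ x in ball a R, ENNReal.ofReal (‖fderiv ℝ (v t) x‖ ^ 2)) ≤ ENNReal.ofReal (K * R))
    (hr : 0 < r) (hz : z.1 ≤ 0) :
    cknE r z (fun t x => fderiv ℝ (v t) x) ≤ ENNReal.ofReal (3 * K) := by
  unfold cknE
  have h1 : (∫⁻ q in parabolicCylinder r z, ENNReal.ofReal (frobeniusNormSq (fderiv ℝ (v q.1) q.2))) ≤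
      ENNReal.ofReal (3 * K * r) := by
    refine (setLIntegral_prod_le _ _ _).trans ?_
    have hmono : (∫⁻ t in Ioo (z.1 - r ^ 2) z.1, ∫⁻ x in ball z.2 r,
        ENNReal.ofReal (frobeniusNormSq (fderiv ℝ (v t) x))) ≤
        ∫⁻ t in Iio z.1, ∫⁻ x in ball z.2 r, ENNReal.ofReal (3 * ‖fderiv ℝ (v t) x‖ ^ 2) := by
      refine (lintegral_mono_set Ioo_subset_Iio_self).trans (lintegral_mono fun t => lintegral_mono fun x => ?_)
      exact ENNReal.ofReal_le_ofReal (ChaeLocalLeray.frobeniusNormSq_le_three _)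
    refine hmono.trans ?_
    have h3 : ∀ t, (∫⁻ x in ball z.2 r, ENNReal.ofReal (3 * ‖fderiv ℝ (v t) x‖ ^ 2)) =
        3 * ∫⁻ x in ball z.2 r, ENNReal.ofReal (‖fderiv ℝ (v t) x‖ ^ 2) := by
      intro t
      rw [← lintegral_const_mul' _ _ (by norm_num : (3 : ℝ≥0∞) ≠ ⊤)]
      refine lintegral_congr fun x => ?_
      rw [ENNReal.ofReal_mul (by norm_num : (0 : ℝ) ≤ 3), ENNReal.ofReal_ofNat]
    simp_rw [h3]
    rw [lintegral_const_mul' _ _ (by norm_num : (3 : ℝ≥0∞) ≠ ⊤)]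
    have h4 := iterated_le_of_lt (G := fun t => ∫⁻ x in ball z.2 r, ENNReal.ofReal (‖fderiv ℝ (v t) x‖ ^ 2))
      (fun t₀ ht₀ => hE t₀ ht₀ z.2 r hr) hz
    calc 3 * (∫⁻ t in Iio z.1, ∫⁻ x in ball z.2 r, ENNReal.ofReal (‖fderiv ℝ (v t) x‖ ^ 2))
        ≤ 3 * ENNReal.ofReal (K * r) := by gcongr
      _ = ENNReal.ofReal (3 * K * r) := by
          rw [show 3 * K * r = 3 * (K * r) by ring, ENNReal.ofReal_mul (by norm_num : (0 : ℝ) ≤ 3),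
            ENNReal.ofReal_ofNat]
  calc (ENNReal.ofReal r)⁻¹ * ∫⁻ q in parabolicCylinder r z, ENNReal.ofReal (frobeniusNormSq (fderiv ℝ (v q.1) q.2))
      ≤ (ENNReal.ofReal r)⁻¹ * ENNReal.ofReal (3 * K * r) := by gcongr
    _ = ENNReal.ofReal (3 * K) := NoApexEnvelope.ofReal_inv_mul_ofReal_mul hr _

/-! ### `D`: the ball mean is nearly the best constant -/

/-- `‖y‖ₑ^{3/2} = ofReal ((√|y|)³)`. -/
theorem enorm_rpow_threeHalves (y : ℝ) : ‖y‖ₑ ^ (3 / 2 : ℝ) = ENNReal.ofReal (Real.sqrt |y| ^ 3) := by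
  rw [Real.enorm_eq_ofReal_abs, ENNReal.ofReal_rpow_of_nonneg (abs_nonneg y) (by norm_num)]
  congr 1
  rw [Real.sqrt_eq_rpow, ← Real.rpow_natCast, ← Real.rpow_mul (abs_nonneg y)]
  norm_num

/-- **The ball mean is within a factor `4` of any constant** (slice Jensen): for `g` integrable on a ball `B` and any
real `c`, `∫⁻_B ‖g − ⨍_B g‖ₑ^{3/2} ≤ 4 ∫⁻_B ‖g − c‖ₑ^{3/2}`. -/
theorem lintegral_ball_sub_average_le {g : EuclideanSpace ℝ (Fin 3) → ℝ} {a : EuclideanSpace ℝ (Fin 3)} {R : ℝ}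
    (hR : 0 < R) (hg : IntegrableOn g (ball a R) volume) (c : ℝ) :
    (∫⁻ x in ball a R, ‖g x - ⨍ y in ball a R, g y‖ₑ ^ (3 / 2 : ℝ)) ≤
      4 * ∫⁻ x in ball a R, ‖g x - c‖ₑ ^ (3 / 2 : ℝ) := by
  set B := ball a R with hB
  have hB0 : volume B ≠ 0 := (measure_ball_pos volume a hR).ne'
  have hBtop : volume B ≠ ∞ := measure_ball_lt_top.ne
  have hgc : IntegrableOn (fun x => g x - c) B volume := hg.sub (integrableOn_const hBtop)
  have hmean : (⨍ y in B, g y) - c = ⨍ y in B, (g y - c) :=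
    (FunctionSpaces.setAverage_sub_const hB0 hBtop hg c).symm
  -- pointwise splitting `‖g − ⨍g‖ₑ^{3/2} ≤ 2(‖g − c‖ₑ^{3/2} + ‖⨍(g − c)‖ₑ^{3/2})`
  have hpt : ∀ x, ‖g x - ⨍ y in B, g y‖ₑ ^ (3 / 2 : ℝ) ≤
      2 * ‖g x - c‖ₑ ^ (3 / 2 : ℝ) + 2 * ‖⨍ y in B, (g y - c)‖ₑ ^ (3 / 2 : ℝ) := by
    intro x
    have heq : g x - ⨍ y in B, g y = (g x - c) - ((⨍ y in B, g y) - c) := by ring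
    rw [heq, hmean]
    calc ‖(g x - c) - ⨍ y in B, (g y - c)‖ₑ ^ (3 / 2 : ℝ)
        ≤ (‖g x - c‖ₑ + ‖⨍ y in B, (g y - c)‖ₑ) ^ (3 / 2 : ℝ) := by
          gcongr; exact enorm_sub_le
      _ ≤ 2 ^ ((3 / 2 : ℝ) - 1) * (‖g x - c‖ₑ ^ (3 / 2 : ℝ) + ‖⨍ y in B, (g y - c)‖ₑ ^ (3 / 2 : ℝ)) :=
          ENNReal.rpow_add_le_mul_rpow_add_rpow _ _ (by norm_num)
      _ ≤ 2 * (‖g x - c‖ₑ ^ (3 / 2 : ℝ) + ‖⨍ y in B, (g y - c)‖ₑ ^ (3 / 2 : ℝ)) := by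
          gcongr
          calc (2 : ℝ≥0∞) ^ ((3 / 2 : ℝ) - 1) ≤ 2 ^ (1 : ℝ) :=
                ENNReal.rpow_le_rpow_of_exponent_le (by norm_num) (by norm_num)
            _ = 2 := ENNReal.rpow_one _
      _ = _ := by ring
  -- Jensen for the average
  have hJ : (∫⁻ _x in B, ‖⨍ y in B, (g y - c)‖ₑ ^ (3 / 2 : ℝ)) ≤ ∫⁻ x in B, ‖g x - c‖ₑ ^ (3 / 2 : ℝ) := by
    rw [setLIntegral_const]
    calc ‖⨍ y in B, (g y - c)‖ₑ ^ (3 / 2 : ℝ) * volume B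
        ≤ ((volume B)⁻¹ * ∫⁻ x in B, ‖g x - c‖ₑ ^ (3 / 2 : ℝ)) * volume B := by
          gcongr
          exact enorm_setAverage_rpow_le hBtop (by norm_num) hgc.aestronglyMeasurable
      _ = ∫⁻ x in B, ‖g x - c‖ₑ ^ (3 / 2 : ℝ) := by
          rw [mul_comm, ← mul_assoc, ENNReal.mul_inv_cancel hB0 hBtop, one_mul]
  have hf : AEMeasurable (fun x => 2 * ‖g x - c‖ₑ ^ (3 / 2 : ℝ)) (volume.restrict B) :=
    (hgc.aestronglyMeasurable.aemeasurable.enorm.pow_const _).const_mul _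
  calc (∫⁻ x in B, ‖g x - ⨍ y in B, g y‖ₑ ^ (3 / 2 : ℝ))
      ≤ ∫⁻ x in B, (2 * ‖g x - c‖ₑ ^ (3 / 2 : ℝ) + 2 * ‖⨍ y in B, (g y - c)‖ₑ ^ (3 / 2 : ℝ)) :=
        lintegral_mono fun x => hpt x
    _ = 2 * (∫⁻ x in B, ‖g x - c‖ₑ ^ (3 / 2 : ℝ)) + 2 * ∫⁻ _x in B, ‖⨍ y in B, (g y - c)‖ₑ ^ (3 / 2 : ℝ) := by
        rw [lintegral_add_left' hf, lintegral_const_mul' _ _ ENNReal.ofNat_ne_top,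
          lintegral_const_mul' _ _ ENNReal.ofNat_ne_top]
    _ ≤ 2 * (∫⁻ x in B, ‖g x - c‖ₑ ^ (3 / 2 : ℝ)) + 2 * ∫⁻ x in B, ‖g x - c‖ₑ ^ (3 / 2 : ℝ) := by
        gcongr _ + 2 * ?_
    _ = 4 * ∫⁻ x in B, ‖g x - c‖ₑ ^ (3 / 2 : ℝ) := by
        rw [← two_mul, ← mul_assoc]; norm_num

/-- **The mean-free `D` only sees the slices of the ball's time window**: if `p t = q t` for every
`t ∈ (z.1 − r², z.1)`, then `D(Q(z,r); p) = D(Q(z,r); q)`. -/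
theorem cknDOsc_congr_slices {p q : ℝ → EuclideanSpace ℝ (Fin 3) → ℝ}
    (h : ∀ t ∈ Ioo (z.1 - r ^ 2) z.1, p t = q t) : cknDOsc r z p = cknDOsc r z q := by
  unfold cknDOsc
  congr 1
  refine setLIntegral_congr_fun (measurableSet_Ioo.prod measurableSet_ball) fun w hw => ?_
  have ht : w.1 ∈ Ioo (z.1 - r ^ 2) z.1 := (mem_prod.1 hw).1
  simp only [h w.1 ht]

/-- **`D(Q(z,r); q) ≤ 4 D₀`** from an iterated bound `∫⁻_{z.1−r²<t<z.1} ∫⁻_{B(z.2,r)} (√|q − c(t)|)³ ≤ D₀ r²` with ANY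
constants `c(t)`, for a pressure whose slices `q(t,·)`, `t ∈ (z.1 − r², z.1)`, are integrable on the ball. -/
theorem cknDOsc_le_of_iterated {q : ℝ → EuclideanSpace ℝ (Fin 3) → ℝ} {D₀ : ℝ} {c : ℝ → ℝ}
    (hq : ∀ t ∈ Ioo (z.1 - r ^ 2) z.1, IntegrableOn (q t) (ball z.2 r) volume)
    (hD : (∫⁻ t in Ioo (z.1 - r ^ 2) z.1, ∫⁻ x in ball z.2 r, ENNReal.ofReal (Real.sqrt |q t x - c t| ^ 3)) ≤
      ENNReal.ofReal (D₀ * r ^ 2))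
    (hr : 0 < r) : cknDOsc r z q ≤ ENNReal.ofReal (4 * D₀) := by
  unfold cknDOsc
  have h1 : (∫⁻ w in parabolicCylinder r z, ‖q w.1 w.2 - ⨍ y in ball z.2 r, q w.1 y‖ₑ ^ (3 / 2 : ℝ)) ≤
      4 * ENNReal.ofReal (D₀ * r ^ 2) := by
    refine (setLIntegral_prod_le _ _ _).trans ?_
    have hslice : ∀ t ∈ Ioo (z.1 - r ^ 2) z.1,
        (∫⁻ x in ball z.2 r, ‖q t x - ⨍ y in ball z.2 r, q t y‖ₑ ^ (3 / 2 : ℝ)) ≤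
          4 * ∫⁻ x in ball z.2 r, ENNReal.ofReal (Real.sqrt |q t x - c t| ^ 3) := by
      intro t ht
      refine (lintegral_ball_sub_average_le hr (hq t ht) (c t)).trans (le_of_eq ?_)
      congr 1
      exact lintegral_congr fun x => enorm_rpow_threeHalves _
    calc (∫⁻ t in Ioo (z.1 - r ^ 2) z.1, ∫⁻ x in ball z.2 r, ‖q t x - ⨍ y in ball z.2 r, q t y‖ₑ ^ (3 / 2 : ℝ))
        ≤ ∫⁻ t in Ioo (z.1 - r ^ 2) z.1, 4 * ∫⁻ x in ball z.2 r, ENNReal.ofReal (Real.sqrt |q t x - c t| ^ 3) :=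
          setLIntegral_mono' measurableSet_Ioo fun t ht => hslice t ht
      _ = 4 * ∫⁻ t in Ioo (z.1 - r ^ 2) z.1, ∫⁻ x in ball z.2 r, ENNReal.ofReal (Real.sqrt |q t x - c t| ^ 3) :=
          lintegral_const_mul' _ _ ENNReal.ofNat_ne_top
      _ ≤ 4 * ENNReal.ofReal (D₀ * r ^ 2) := by gcongr
  calc (ENNReal.ofReal r ^ 2)⁻¹ *
        ∫⁻ w in parabolicCylinder r z, ‖q w.1 w.2 - ⨍ y in ball z.2 r, q w.1 y‖ₑ ^ (3 / 2 : ℝ)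
      ≤ (ENNReal.ofReal r ^ 2)⁻¹ * (4 * ENNReal.ofReal (D₀ * r ^ 2)) := by gcongr
    _ = (ENNReal.ofReal r ^ 2)⁻¹ * ENNReal.ofReal ((4 * D₀) * r ^ 2) := by
        congr 1
        rw [← ENNReal.ofReal_ofNat 4, ← ENNReal.ofReal_mul (by norm_num : (0 : ℝ) ≤ 4)]
        congr 1
        ring
    _ = ENNReal.ofReal (4 * D₀) := ofReal_sq_inv_mul hr _

/-! ### Two classical pressures differ by a function of time -/

/-- **Two classical pressures of the same velocity field on a common OPEN time set differ by a function of time**: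
`q t x − q' t x = q t x₀ − q' t x₀` (the momentum equations give `∇q(t) = ∇q'(t)`; the one-sided time derivatives
agree on open sets). -/
theorem pressure_sub_eq_of_classical {S S' : Set ℝ} (hS : IsOpen S) (hS' : IsOpen S') {ν : ℝ}
    {q q' : ℝ → EuclideanSpace ℝ (Fin 3) → ℝ}
    (h : IsClassicalNSSolutionOn S ν 0 v q) (h' : IsClassicalNSSolutionOn S' ν 0 v q')
    {t : ℝ} (ht : t ∈ S) (ht' : t ∈ S') (x x₀ : EuclideanSpace ℝ (Fin 3)) :
    q t x - q' t x = q t x₀ - q' t x₀ := by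
  have hgrad : ∀ y, gradient (q t) y = gradient (q' t) y := by
    intro y
    have h1 := h.momentum t ht y
    have h2 := h'.momentum t ht' y
    rw [timeDerivWithin_apply, derivWithin_of_isOpen hS ht] at h1
    rw [timeDerivWithin_apply, derivWithin_of_isOpen hS' ht'] at h2
    have h3 := h1.symm.trans h2
    simpa using h3
  have hdq : Differentiable ℝ (q t) := (h.contDiff_pressure ht).differentiable (by simp)
  have hdq' : Differentiable ℝ (q' t) := (h'.contDiff_pressure ht').differentiable (by simp)
  have hd : Differentiable ℝ (fun y => q t y - q' t y) := hdq.sub hdq'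
  have hzero : ∀ y, fderiv ℝ (fun y => q t y - q' t y) y = 0 := by
    intro y
    rw [fderiv_fun_sub (hdq y) (hdq' y)]
    have e1 : fderiv ℝ (q t) y = (InnerProductSpace.toDual ℝ (EuclideanSpace ℝ (Fin 3))) (gradient (q t) y) := by
      simp [gradient]
    have e2 : fderiv ℝ (q' t) y = (InnerProductSpace.toDual ℝ (EuclideanSpace ℝ (Fin 3))) (gradient (q' t) y) := by
      simp [gradient]
    rw [e1, e2, hgrad y, sub_self]
  exact is_const_of_fderiv_eq_zero hd hzero x x₀

end Summit.NavierStokesRegularity.NavierStokesRegularity.Theorems.AxisTwistDoorTiltDominationLocScaledQuantities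

end
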